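import Literature.AlgebraicGeometry.Resolution.KummerOneUnitsNormalForm
import Mathlib.RingTheory.RootsOfUnity.PrimitiveRoots
import Mathlib.FieldTheory.KummerExtension
import HarnessLib

/-!
# Galois extensions of degree `p` in mixed characteristic: the residue degree is `p` (Kuhlmann 2010, Prop. 4.13)

Topic: `Literature/AlgebraicGeometry/Resolution` (valued function fields). The residue
computation of F.-V. Kuhlmann, *Elimination of ramification I: The generalized stability
theorem*, Trans. AMS 362 (2010) 5697–5727 = arXiv:1003.5678, **Prop. 4.13** ("In all cases,
`[Ē:F̄] = p`"), towards the named fact `Kuhlmann2010Prop413ResidueDegree`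
(`NormalDegreePDefectlessGalois.lean`), the mixed characteristic leaf of the decomposition of
`Kuhlmann2010Stability` (`GeneralizedStabilityTrustBase.lean`). Printed proof (p. 17 of the arXiv
version):

> We can assume that `E|F` is of the form (4.7) [`E = F(ϑ)`, `a := ϑ^p ∈ F`]. Since `vF = vK`, we
> can write `a = cb` where `c ∈ K` with `vc = va`. Using (4.8) and our assumption that `K` is
> closed under `p`-th roots, we may replace `a` by `b`. Now `vb = 0`, so `b̄ ≠ 0`. If `b̄` is a
> `p`-th power in `F̄`, then we may choose `b₀ ∈ F` with `b̄₀ = b̄^{1/p}` and write `b = b₀^p u`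
> with `u` a `1`-unit. … we may further assume that `u = 1 + ∑ cᵢuᵢ` … It remains to prove the
> last assertions of the lemma. If `r̄ ∉ F̄^p` then `ϑ̄ = r̄^{1/p} ∉ F̄`. Now assume that `r = 1`.
> By Lemma 2.9 we know that `C ∈ K`. Performing the transformation (6), we find that
> `η := (ϑ-1)/C` is a root of the polynomial (7), where `b = ∑ cᵢuᵢ`. Suppose first that
> `vcᵢuᵢ = (p/(p-1))vp` for all `i ∈ I`. Then `vbC^{-p} = 0`, and the residue polynomial
> `Z^p - Z - (bC^{-p})‾` does not admit a zero in `F̄` since otherwise `η ∈ F` by Hensel's Lemma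
> and `E|F` would be trivial … Now suppose that `vcᵢuᵢ < (p/(p-1))vp` for some `i ∈ I`. …
> `vη = (1/p)vbC^{-p} = (1/p)vcⱼ - vC < 0`. By our assumption on `K` there is some `d ∈ K` such
> that `d^p = cⱼ^{-1}`. … for `χ := dCη` we obtain: `χ^p - (dC)^{p-1}χ = … = cⱼ^{-1} ∑ cᵢuᵢ`.
> As in Proposition 4.12 we see that `χ̄ ∉ F̄`. In all cases, we find that `[Ē:F̄] ≥ p` and
> hence, `[Ē:F̄] = p` by the fundamental inequality.

## Content (everything PROVED)

* `kummerPoly_monic_coeff` — the transformed polynomial `f(Y) = (Y + C⁻¹)^p - (1+b)C^{-p}` of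
  §2.2, (5)–(8): monic, coefficients in `V ∩ F` for `v(b) ≥ v(C)^p`…, unit derivative at units.
* `exists_isPrimitiveRoot` — **Lemma 2.9 (⇒)**: `C ∈ F` henselian gives a primitive `p`-th root
  of unity in `F` (Hensel's Lemma on `f` with `b = 0` at `Y = 1`).
* `exists_kummer_generator_of_isPrimitiveRoot` — (4.7)/[L] Thm. 6.2: a Galois extension of degree
  `p` is generated by a `p`-th root (Mathlib's `exists_root_adjoin_eq_top_of_isCyclic`).
* `add_inv_pow_sub_eq`, `valuation_G_term_le`, `valuation_G_lt_one`, `valuation_G_lt_pow`,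
  `valuation_root_transform` — the transform (6)–(8) `f(η) = η^p - η + G(η) - b/C^p` and the size
  of its roots ("`vη < 0` … `pvη = vb/C^p` by the ultrametric triangle law").
* `IsDenseLiftedFrobeniusClosedBasis.le_relfinrank_residue_of_isGaloisStep`,
  `IsDenseLiftedFrobeniusClosedBasis.relfinrank_residue_eq_of_isGaloisStep` — **Prop. 4.13**:
  `[Ē : F̄] = p` for every Galois extension `E|F` of degree `p`, for `F` as in the module docstring
  of `KummerOneUnitsNormalForm.lean` with `vF = vK` and `C ∈ K`, carrying a dense lifted
  Frobenius-closed basis over `K`.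

## Sources

* F.-V. Kuhlmann, *Elimination of ramification I: The generalized stability theorem*, Trans.
  Amer. Math. Soc. 362 (2010) 5697–5727 = arXiv:1003.5678: §1 (1), §2.2 ((5)–(8), Lemmas
  2.9–2.10, Cor. 2.11), §4 ((4.7), (4.8)), §4.2 (Lemma 4.8 b)), §4.3 (Prop. 4.13 and its proof,
  p. 17). [Kuhlmann2010]
* S. Lang, *Algebra*, GTM 211, Ch. VI §6, Thm. 6.2 (Kummer extensions) — through Mathlib
  (`Mathlib.FieldTheory.KummerExtension`).

## Rendering notes

* As in `KummerOneUnitsNormalForm.lean`; in addition `char Ωv = p` (`CharP (ResidueField V) p`,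
  giving `v(p) < 1`) and `vF = vK` as `∀ a ∈ F, a ≠ 0 → ∃ c ∈ K, v(c) = v(a)`; `E|F` Galois of
  degree `p` is `IsGaloisStep p F E` (`NormalDegreePDefectless.lean`); `[Ē : F̄]` is
  `(residueSubfield F V).relfinrank (residueSubfield E V)`, as in the named fact
  `Kuhlmann2010Prop413ResidueDegree`.
* The two exits "`[Ē:F̄] ≥ p`" are `le_relfinrank_residue_of_pow_sub_self_eq` (Artin–Schreier) and
  `le_relfinrank_residue_of_pow_eq` (purely inseparable) of `GaloisDegreePDefectless.lean`; Lemma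
  4.8 b) is `exists_apply_eq_of_linearCombination_eq_pow` of `FrobeniusClosedBases.lean`.
* What is NOT here: the construction of a dense lifted Frobenius-closed basis for the fields of
  the class `IsHenselizedInertiallyGeneratedRT` (Lemma 4.11: the discretely valued subfield
  `K₀ ⊆ K`, the function field `F₀`, and a Frobenius-closed basis of the function field `F̄|K̄`,
  [K5] Thm. 10) — the remaining step towards `Kuhlmann2010Prop413ResidueDegree_holds`.
-/

noncomputable section

open IsLocalRing

namespace Literature.AlgebraicGeometry.Resolution

universe u

variable {Ω : Type u} [Field Ω] (V : ValuationSubring Ω)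

/-! ### A primitive `p`-th root of unity from `C` (Lemma 2.9) -/

section RootsOfUnity

variable {V} {p : ℕ} [hp : Fact p.Prime] {F : Subfield Ω}
variable (hF : IsHenselianField F (V.comap (algebraMap F Ω)))
  {C : Ω} (hCF : C ∈ F) (hC : C ^ (p - 1) = -(p : Ω)) (hp0 : (p : Ω) ≠ 0)
  (hvp : V.valuation (p : Ω) < 1)

/-- The transformed Kummer polynomial `f(Y) = (Y + C⁻¹)^p - (1 + b)C^{-p}` (Kuhlmann 2010, §2.2,
(5)–(8): the transform `X = CY + 1` of `X^p - (1 + b)`, divided by `C^p`) is monic with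
coefficients in `V ∩ F` when `b ∈ F` and `v(b) ≤ v(C)^p`; its derivative at an element `s` of
value `≤ 1` is a unit. PROVED (as in `exists_pow_eq_one_add_of_valuation_lt`).
[cite: Kuhlmann2010, Section 2.2, (5)–(8)] -/
theorem kummerPoly_monic_coeff (hC : C ^ (p - 1) = -(p : Ω)) (hp0 : (p : Ω) ≠ 0)
    (hvp : V.valuation (p : Ω) < 1) (hCF : C ∈ F) {b : Ω} (hbF : b ∈ F)
    (hb : V.valuation b ≤ V.valuation C ^ p) :
    ((Polynomial.X + Polynomial.C C⁻¹) ^ p - Polynomial.C ((1 + b) * C⁻¹ ^ p)).Monic ∧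
    (∀ k, ((Polynomial.X + Polynomial.C C⁻¹) ^ p - Polynomial.C ((1 + b) * C⁻¹ ^ p)).coeff k ∈ V ∧
      ((Polynomial.X + Polynomial.C C⁻¹) ^ p - Polynomial.C ((1 + b) * C⁻¹ ^ p)).coeff k ∈ F) ∧
    ∀ s ∈ V, V.valuation ((Polynomial.derivative
      ((Polynomial.X + Polynomial.C C⁻¹) ^ p - Polynomial.C ((1 + b) * C⁻¹ ^ p))).eval s) = 1 := by
  classical
  have hC0 : C ≠ 0 := C_ne_zero hp.out hC hp0
  have hvC0 : V.valuation C ≠ 0 := (map_ne_zero _).mpr hC0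
  have hvC1 : V.valuation C < 1 := valuation_C_lt_one V hC hvp
  have hvCp : V.valuation C ^ (p - 1) = V.valuation (p : Ω) := valuation_pow_pred_eq V hC
  set d : Ω := C⁻¹ with hd
  have hdF : d ∈ F := F.inv_mem hCF
  set f : Polynomial Ω :=
    (Polynomial.X + Polynomial.C d) ^ p - Polynomial.C ((1 + b) * d ^ p) with hf
  have hmon : f.Monic := by
    refine ((Polynomial.monic_X_add_C d).pow p).sub_of_left (lt_of_le_of_lt Polynomial.degree_C_le ?_)
    rw [Polynomial.degree_pow, Polynomial.degree_X_add_C, nsmul_one, Nat.cast_pos]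
    exact hp.out.pos
  have hcoefX : ∀ k, ((Polynomial.X + Polynomial.C d) ^ p).coeff k = d ^ (p - k) * (p.choose k : Ω) :=
    fun k => Polynomial.coeff_X_add_C_pow d p k
  have hnatV : ∀ n : ℕ, V.valuation (n : Ω) ≤ 1 := fun n => V.valuation_le_one_iff _ |>.mpr (natCast_mem V n)
  have hcoef : ∀ k, f.coeff k ∈ V ∧ f.coeff k ∈ F := by
    intro k
    have hkF : f.coeff k ∈ F := by
      rw [hf, Polynomial.coeff_sub, hcoefX, Polynomial.coeff_C]
      refine sub_mem (mul_mem (pow_mem hdF _) (natCast_mem F _)) ?_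
      split_ifs
      · exact mul_mem (add_mem F.one_mem hbF) (pow_mem hdF _)
      · exact F.zero_mem
    refine ⟨(V.valuation_le_one_iff _).mp ?_, hkF⟩
    rw [hf, Polynomial.coeff_sub, hcoefX, Polynomial.coeff_C]
    rcases Nat.lt_or_ge p k with hpk | hkp
    · rw [Nat.choose_eq_zero_of_lt hpk, Nat.cast_zero, mul_zero, if_neg (by omega), sub_zero, map_zero]
      exact zero_le_one
    rcases hkp.eq_or_lt with rfl | hkp'
    · rw [Nat.sub_self, pow_zero, Nat.choose_self, Nat.cast_one, mul_one, if_neg hp.out.ne_zero,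
        sub_zero, map_one]
    rcases Nat.eq_zero_or_pos k with rfl | hk0
    · rw [if_pos rfl, Nat.sub_zero, Nat.choose_zero_right, Nat.cast_one, mul_one,
        show d ^ p - (1 + b) * d ^ p = -(b * d ^ p) by ring, Valuation.map_neg, map_mul, map_pow,
        hd, map_inv₀, inv_pow, mul_inv_le_iff₀ (pow_pos (zero_lt_iff.mpr hvC0) _), one_mul]
      exact hb
    · rw [if_neg hk0.ne', sub_zero, map_mul, map_pow, hd, map_inv₀, inv_pow]
      obtain ⟨m, hm⟩ := hp.out.dvd_choose_self hk0.ne' hkp'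
      have h1 : V.valuation ((p.choose k : ℕ) : Ω) ≤ V.valuation C ^ (p - 1) := by
        rw [hm, Nat.cast_mul, map_mul, hvCp]
        calc V.valuation (p : Ω) * V.valuation (m : Ω) ≤ V.valuation (p : Ω) * 1 :=
              mul_le_mul_right (hnatV m) _
          _ = V.valuation (p : Ω) := mul_one _
      have h2 : V.valuation C ^ (p - 1) = V.valuation C ^ (p - k) * V.valuation C ^ (k - 1) := by
        rw [← pow_add]; congr 1; omega
      rw [inv_mul_le_iff₀ (pow_pos (zero_lt_iff.mpr hvC0) _)]
      calc V.valuation ((p.choose k : ℕ) : Ω) ≤ V.valuation C ^ (p - 1) := h1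
        _ = V.valuation C ^ (p - k) * V.valuation C ^ (k - 1) := h2
        _ ≤ V.valuation C ^ (p - k) * 1 := mul_le_mul_right (pow_le_one₀ zero_le hvC1.le) _
  refine ⟨hmon, hcoef, fun s hs => ?_⟩
  -- the derivative `p (Y + d)^{p-1}` at `s`: value `v(p) v(d)^{p-1} = 1`
  have hds : V.valuation (s + d) = V.valuation d := by
    rw [add_comm]
    refine Valuation.map_add_eq_of_lt_left _ ?_
    rw [hd, map_inv₀]
    exact ((V.valuation_le_one_iff s).mpr hs).trans_lt (one_lt_inv₀ (zero_lt_iff.mpr hvC0) |>.mpr hvC1)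
  rw [hf, Polynomial.derivative_sub, Polynomial.derivative_C, sub_zero,
    Polynomial.derivative_X_add_C_pow, Polynomial.eval_mul, Polynomial.eval_C, Polynomial.eval_pow,
    Polynomial.eval_add, Polynomial.eval_X, Polynomial.eval_C, map_mul, map_pow, hds, hd, map_inv₀,
    inv_pow, ← hvCp, mul_inv_cancel₀ (pow_ne_zero _ hvC0)]

include hF hCF hC hp0 hvp in
/-- **A primitive `p`-th root of unity in `F`** (Kuhlmann 2010, Lemma 2.9: "`K` contains `C` if
and only if it contains all `p`-th roots of unity"; the direction ⇒, proved as printed: the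
transform `f(Y) = (Y + C⁻¹)^p - C^{-p}` of `X^p - 1` reduces to `Y^p - Y`, which has the simple
root `1` in `𝔽_p`; Hensel's Lemma lifts it to a root `y ≢ 0`, and `ζ = Cy + 1 ≠ 1` has `ζ^p = 1`).
[cite: Kuhlmann2010, Lemma 2.9] -/
theorem exists_isPrimitiveRoot : ∃ ζ ∈ F, IsPrimitiveRoot ζ p := by
  classical
  have hC0 : C ≠ 0 := C_ne_zero hp.out hC hp0
  have hvC0 : V.valuation C ≠ 0 := (map_ne_zero _).mpr hC0
  have hvC1 : V.valuation C < 1 := valuation_C_lt_one V hC hvp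
  have hvCp : V.valuation C ^ (p - 1) = V.valuation (p : Ω) := valuation_pow_pred_eq V hC
  obtain ⟨hmon, hcoef, hder⟩ := kummerPoly_monic_coeff (V := V) hC hp0 hvp hCF F.zero_mem
    (by rw [map_zero]; exact zero_le)
  set d : Ω := C⁻¹ with hd
  set f : Polynomial Ω := (Polynomial.X + Polynomial.C d) ^ p - Polynomial.C ((1 + 0) * d ^ p) with hf
  have heval : ∀ x, f.eval x = (x + d) ^ p - d ^ p := fun x => by
    rw [hf]; simp
  -- `v(f(1)) < 1`: `(1 + d)^p - d^p = ∑_{1 ≤ k ≤ p-2} binom(p,k) d^k` after `1 + p d^{p-1} = 0`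
  obtain ⟨q, hq⟩ : ∃ q, p = q + 2 := ⟨p - 2, by have := hp.out.two_le; omega⟩
  have hpd : (p : Ω) * d ^ (p - 1) = -1 := by
    rw [hd, inv_pow, hC, inv_neg, mul_neg, mul_inv_cancel₀ hp0]
  have hnatV : ∀ n : ℕ, V.valuation (n : Ω) ≤ 1 := fun n => V.valuation_le_one_iff _ |>.mpr (natCast_mem V n)
  have hf1 : V.valuation (f.eval 1) < 1 := by
    rw [heval]
    have hexp : (1 + d) ^ p - d ^ p = ∑ k ∈ Finset.range q, d ^ (k + 1) * (p.choose (k + 1) : Ω) := by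
      rw [add_comm, add_pow, hq, Finset.sum_range_succ, Finset.sum_range_succ']
      simp only [one_pow, mul_one, Nat.choose_self, Nat.cast_one, pow_zero, Nat.choose_zero_right]
      have h1 : ∑ k ∈ Finset.range (q + 1), d ^ (k + 1) * (((q + 2).choose (k + 1) : ℕ) : Ω) =
          ∑ k ∈ Finset.range q, d ^ (k + 1) * (((q + 2).choose (k + 1) : ℕ) : Ω) +
            d ^ (q + 1) * (((q + 2).choose (q + 1) : ℕ) : Ω) := Finset.sum_range_succ _ q
      rw [h1, Nat.choose_succ_self_right, show q + 1 + 1 = q + 2 by ring]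
      have h2 : d ^ (q + 1) * ((q + 2 : ℕ) : Ω) = -1 := by
        rw [← hpd, hq, mul_comm]; congr 1
      rw [h2, ← hq]
      ring
    rw [hexp]
    refine Valuation.map_sum_lt _ one_ne_zero fun k hk => ?_
    rw [Finset.mem_range] at hk
    -- `p ∣ binom(p, k+1)` and `v(d)^{k+1} = v(C)^{-(k+1)}`, `k + 1 ≤ p - 2`
    obtain ⟨m, hm⟩ := hp.out.dvd_choose_self (Nat.succ_ne_zero k) (by omega)
    rw [map_mul, hm, Nat.cast_mul, map_mul, ← hvCp, map_pow, hd, map_inv₀, inv_pow]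
    have hsplit : V.valuation C ^ (p - 1) = V.valuation C ^ (k + 1) * V.valuation C ^ (p - 1 - (k + 1)) := by
      rw [← pow_add]; congr 1; omega
    rw [hsplit, mul_assoc (V.valuation C ^ (k + 1)), inv_mul_cancel_left₀ (pow_ne_zero _ hvC0)]
    calc V.valuation C ^ (p - 1 - (k + 1)) * V.valuation (m : Ω) ≤ V.valuation C ^ (p - 1 - (k + 1)) * 1 :=
          mul_le_mul_right (hnatV m) _
      _ < 1 := by rw [mul_one]; exact pow_lt_one₀ zero_le hvC1 (by omega)
  have hder1 := hder 1 V.one_mem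
  obtain ⟨y, hyF, hyV, hy, hy1⟩ :=
    exists_root_of_isHenselianField V hF hmon hcoef F.one_mem V.one_mem hf1 hder1
  have hy0 : y ≠ 0 := by
    rintro rfl
    rw [zero_sub, Valuation.map_neg, map_one] at hy1
    exact lt_irrefl _ hy1
  -- `ζ = C y + 1`
  have hroot : (y + d) ^ p = d ^ p := by
    have := hy
    rw [heval] at this
    exact sub_eq_zero.mp this
  refine ⟨C * y + 1, add_mem (mul_mem hCF hyF) F.one_mem, ?_⟩
  have hζp : (C * y + 1) ^ p = 1 := by
    have : C * y + 1 = C * (y + d) := by rw [hd, mul_add, mul_inv_cancel₀ hC0]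
    rw [this, mul_pow, hroot, hd, inv_pow, mul_inv_cancel₀ (pow_ne_zero _ hC0)]
  have hζ1 : C * y + 1 ≠ 1 := by
    intro h1
    rw [add_eq_right] at h1
    exact mul_ne_zero hC0 hy0 h1
  have horder := orderOf_eq_prime hζp hζ1
  rw [← horder]
  exact IsPrimitiveRoot.orderOf _

end RootsOfUnity

/-! ### Kummer generators of Galois extensions of degree `p` -/

section KummerGenerator

variable {V} {p : ℕ} [hp : Fact p.Prime] {F : Subfield Ω}

/-- **Kummer generator** (Kuhlmann 2010, §4, (4.4)/(10): "If `char K = 0` and `K` contains all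
`p`-th roots of unity, then `E|F` is a Kummer extension (cf. [L], Theorem 6.2). That is, the
extension is of the form `E = F(ϑ)` where `a := ϑ^p ∈ F`"): a Galois extension `E|F` of degree `p`
inside `Ω`, with a primitive `p`-th root of unity in `F`, contains `ϑ ∉ F` with `ϑ^p ∈ F`.
PROVED from Mathlib's Kummer theory (`exists_root_adjoin_eq_top_of_isCyclic`: a cyclic extension
of degree `n` over a field with the `n`-th roots of unity is generated by an `n`-th root).
[cite: Kuhlmann2010, Section 4, (4.4)] -/
theorem exists_kummer_generator_of_isPrimitiveRoot {E : Subfield Ω} (hstep : IsGaloisStep p F E)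
    (hζ : ∃ ζ ∈ F, IsPrimitiveRoot ζ p) : ∃ ϑ ∈ E, ϑ ∉ F ∧ ϑ ^ p ∈ F := by
  obtain ⟨hle, hdeg, hgal⟩ := hstep
  set E' : IntermediateField F Ω := Subfield.extendScalars hle with hE'
  haveI := hgal
  haveI : FiniteDimensional F E' := Module.finite_of_finrank_pos (by rw [hdeg]; exact hp.out.pos)
  haveI : IsCyclic (E' ≃ₐ[F] E') :=
    isCyclic_of_prime_card (p := p) (by rw [IsGalois.card_aut_eq_finrank, hdeg])
  obtain ⟨ζ, hζF, hζ⟩ := hζ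
  have hprim : (primitiveRoots (Module.finrank F E') F).Nonempty := by
    refine ⟨⟨ζ, hζF⟩, ?_⟩
    rw [hdeg, mem_primitiveRoots hp.out.pos]
    exact (IsPrimitiveRoot.map_iff_of_injective (f := F.subtype) Subtype.val_injective).mp hζ
  obtain ⟨α, ⟨c, hc⟩, htop⟩ := exists_root_adjoin_eq_top_of_isCyclic F E' hprim
  refine ⟨(α : Ω), α.2, fun hαF => ?_, ?_⟩
  · -- `α ∈ F` would give `F⟮α⟯ = ⊥`, degree `1`
    have hbot : (α : E') ∈ (⊥ : IntermediateField F E') := by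
      rw [IntermediateField.mem_bot]
      exact ⟨⟨(α : Ω), hαF⟩, Subtype.ext rfl⟩
    have h1 : IntermediateField.adjoin F {α} = ⊥ := IntermediateField.adjoin_simple_eq_bot_iff.mpr hbot
    rw [h1] at htop
    have : Module.finrank F E' = 1 := by
      rw [← IntermediateField.finrank_top', ← htop, IntermediateField.finrank_bot]
    rw [hdeg] at this
    exact hp.out.one_lt.ne' this
  · have h2 : ((α ^ Module.finrank F E' : E') : Ω) = ((algebraMap F E' c : E') : Ω) := by rw [hc]
    rw [hdeg] at h2
    have h3 : ((α ^ p : E') : Ω) = ((α : E') : Ω) ^ p := rfl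
    rw [← h3, h2]
    exact c.2

end KummerGenerator

/-! ### The transformed equation `η^p - η + G(η) = β` and its values -/

section Transform

variable {V} {p : ℕ} [hp : Fact p.Prime]

/-- **The transform `X = CY + 1`** (Kuhlmann 2010, §2.2, (6)–(8): "dividing by `C^p` and using
that `C^p = -pC`, we obtain the polynomial `f(Y) = Y^p + g(Y) - Y - b/C^p` with
`g(Y) = ∑_{i=2}^{p-1} binom(p,i) C^{i-p} Yⁱ`"): for `d = C⁻¹`,
`(x + d)^p - (1 + b)d^p = x^p - x + G(x) - b d^p` with
`G(x) = ∑_{2 ≤ i ≤ p-1} binom(p,i) d^{p-i} xⁱ`. PROVED (binomial theorem, `p d^{p-1} = -1`).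
[cite: Kuhlmann2010, Section 2.2, (6)–(8)] -/
theorem add_inv_pow_sub_eq {C : Ω} (hC : C ^ (p - 1) = -(p : Ω)) (hp0 : (p : Ω) ≠ 0) (x b : Ω) :
    (x + C⁻¹) ^ p - (1 + b) * C⁻¹ ^ p =
      x ^ p - x + (∑ k ∈ Finset.range (p - 2), x ^ (k + 2) * C⁻¹ ^ (p - (k + 2)) * (p.choose (k + 2) : Ω)) -
        b * C⁻¹ ^ p := by
  obtain ⟨q, hq⟩ : ∃ q, p = q + 2 := ⟨p - 2, by have := hp.out.two_le; omega⟩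
  set d := C⁻¹ with hd
  have hpd : (p : Ω) * d ^ (p - 1) = -1 := by
    rw [hd, inv_pow, hC, inv_neg, mul_neg, mul_inv_cancel₀ hp0]
  have hexp : (x + d) ^ p = x ^ p + d ^ p - x +
      ∑ k ∈ Finset.range (p - 2), x ^ (k + 2) * d ^ (p - (k + 2)) * (p.choose (k + 2) : Ω) := by
    rw [add_pow, hq, show q + 2 - 2 = q from rfl, Finset.sum_range_succ, Finset.sum_range_succ',
      Finset.sum_range_succ']
    simp only [pow_zero, one_mul, Nat.choose_zero_right, Nat.cast_one, mul_one, Nat.sub_zero,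
      Nat.choose_self, Nat.sub_self, zero_add, pow_one]
    have h1 : x * d ^ (q + 2 - 1) * (((q + 2).choose 1 : ℕ) : Ω) = -x := by
      rw [Nat.choose_one_right, show q + 2 - 1 = p - 1 by omega, mul_assoc, mul_comm (d ^ (p - 1)),
        ← hq, hpd, mul_neg, mul_one]
    rw [h1]
    ring
  rw [hexp]
  ring

/-- The values of the terms of `G`: `v(binom(p,i) d^{p-i} xⁱ) ≤ v(C)^{i-1} v(x)ⁱ`. [folklore] -/
theorem valuation_G_term_le {C : Ω} (hC : C ^ (p - 1) = -(p : Ω)) (hp0 : (p : Ω) ≠ 0) (x : Ω) {k : ℕ}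
    (hk : k < p - 2) :
    V.valuation (x ^ (k + 2) * C⁻¹ ^ (p - (k + 2)) * (p.choose (k + 2) : Ω)) ≤
      V.valuation C ^ (k + 1) * V.valuation x ^ (k + 2) := by
  have hC0 : C ≠ 0 := C_ne_zero hp.out hC hp0
  have hvC0 : V.valuation C ≠ 0 := (map_ne_zero _).mpr hC0
  have hnatV : ∀ n : ℕ, V.valuation (n : Ω) ≤ 1 := fun n => V.valuation_le_one_iff _ |>.mpr (natCast_mem V n)
  obtain ⟨m, hm⟩ := hp.out.dvd_choose_self (Nat.succ_ne_zero (k + 1)) (by omega)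
  rw [map_mul, map_mul, map_pow, map_pow, map_inv₀, hm, Nat.cast_mul, map_mul, ← valuation_pow_pred_eq V hC]
  have hsplit : V.valuation C ^ (p - 1) = V.valuation C ^ (p - (k + 2)) * V.valuation C ^ (k + 1) := by
    rw [← pow_add]; congr 1; omega
  rw [hsplit, inv_pow, mul_assoc, mul_assoc, ← mul_assoc ((V.valuation C ^ (p - (k + 2)))⁻¹),
    inv_mul_cancel₀ (pow_ne_zero _ hvC0), one_mul, mul_comm]
  calc V.valuation C ^ (k + 1) * V.valuation (m : Ω) * V.valuation x ^ (k + 2)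
      ≤ V.valuation C ^ (k + 1) * 1 * V.valuation x ^ (k + 2) :=
        mul_le_mul_left (mul_le_mul_right (hnatV m) _) _
    _ = V.valuation C ^ (k + 1) * V.valuation x ^ (k + 2) := by rw [mul_one]

/-- `v(G(x)) < 1` for `v(x) ≤ 1` (indeed `≤ v(C)`). [folklore] -/
theorem valuation_G_lt_one {C : Ω} (hC : C ^ (p - 1) = -(p : Ω)) (hp0 : (p : Ω) ≠ 0)
    (hvp : V.valuation (p : Ω) < 1) {x : Ω} (hx : V.valuation x ≤ 1) :
    V.valuation (∑ k ∈ Finset.range (p - 2), x ^ (k + 2) * C⁻¹ ^ (p - (k + 2)) * (p.choose (k + 2) : Ω)) < 1 := by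
  have hvC1 : V.valuation C < 1 := valuation_C_lt_one V hC hvp
  refine Valuation.map_sum_lt _ one_ne_zero fun k hk => ?_
  rw [Finset.mem_range] at hk
  refine (valuation_G_term_le hC hp0 x hk).trans_lt ?_
  calc V.valuation C ^ (k + 1) * V.valuation x ^ (k + 2) ≤ V.valuation C ^ (k + 1) * 1 :=
        mul_le_mul_right (pow_le_one₀ zero_le hx) _
    _ < 1 := by rw [mul_one]; exact pow_lt_one₀ zero_le hvC1 (Nat.succ_ne_zero k)

/-- `v(G(x)) < v(x)^p` and `v(x) < v(x)^p` for `v(x) > 1`. [folklore] -/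
theorem valuation_G_lt_pow {C : Ω} (hC : C ^ (p - 1) = -(p : Ω)) (hp0 : (p : Ω) ≠ 0)
    (hvp : V.valuation (p : Ω) < 1) {x : Ω} (hx : 1 < V.valuation x) :
    V.valuation (∑ k ∈ Finset.range (p - 2), x ^ (k + 2) * C⁻¹ ^ (p - (k + 2)) * (p.choose (k + 2) : Ω)) <
      V.valuation x ^ p ∧ V.valuation x < V.valuation x ^ p := by
  have hvC1 : V.valuation C < 1 := valuation_C_lt_one V hC hvp
  have hx0 : V.valuation x ^ p ≠ 0 := pow_ne_zero _ (ne_of_gt (lt_trans zero_lt_one hx))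
  refine ⟨Valuation.map_sum_lt _ hx0 fun k hk => ?_, ?_⟩
  · rw [Finset.mem_range] at hk
    refine (valuation_G_term_le hC hp0 x hk).trans_lt ?_
    calc V.valuation C ^ (k + 1) * V.valuation x ^ (k + 2) ≤ 1 * V.valuation x ^ (k + 2) :=
          mul_le_mul_left (pow_le_one₀ zero_le hvC1.le) _
      _ = V.valuation x ^ (k + 2) := one_mul _
      _ < V.valuation x ^ p := pow_lt_pow_right₀ hx (by omega)
  · calc V.valuation x = V.valuation x ^ 1 := (pow_one _).symm
      _ < V.valuation x ^ p := pow_lt_pow_right₀ hx hp.out.one_lt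

/-- **Size of a root `η` of `η^p - η + G(η) = β`.** If `v(β) ≤ 1` then `v(η) ≤ 1`; if `v(β) > 1`
then `v(η) > 1`, `v(η)^p = v(β)` and `v(η^p - β) < v(η)^p` (Kuhlmann 2010, proof of Prop. 4.6: "we
have that `vb/C^p < 0` … this implies that `vη < 0`. It follows that `vη^p < vη` and
`vη^p < vdᵢηⁱ` … Consequently, `pvη = vb/C^p` by the ultrametric triangle law"). PROVED.
[cite: Kuhlmann2010, Prop. 4.6 (proof) and Prop. 4.13 (proof)] -/
theorem valuation_root_transform {C : Ω} (hC : C ^ (p - 1) = -(p : Ω)) (hp0 : (p : Ω) ≠ 0)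
    (hvp : V.valuation (p : Ω) < 1) {η β : Ω}
    (hroot : η ^ p - η + (∑ k ∈ Finset.range (p - 2), η ^ (k + 2) * C⁻¹ ^ (p - (k + 2)) * (p.choose (k + 2) : Ω)) - β = 0) :
    (V.valuation β ≤ 1 → V.valuation η ≤ 1) ∧
    (1 < V.valuation β → 1 < V.valuation η ∧ V.valuation η ^ p = V.valuation β ∧
      V.valuation (η ^ p - β) < V.valuation η ^ p) := by
  set G := ∑ k ∈ Finset.range (p - 2), η ^ (k + 2) * C⁻¹ ^ (p - (k + 2)) * (p.choose (k + 2) : Ω) with hG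
  -- if `v(η) > 1` then `v(η^p)` dominates `η` and `G`
  have hbig : 1 < V.valuation η → V.valuation (-η + G) < V.valuation η ^ p := fun hη => by
    obtain ⟨h1, h2⟩ := valuation_G_lt_pow (V := V) hC hp0 hvp hη
    exact Valuation.map_add_lt _ (by rwa [Valuation.map_neg]) h1
  have hβeq : β = η ^ p + (-η + G) := by
    have := sub_eq_zero.mp hroot
    rw [← this]; ring
  constructor
  · intro hβ
    by_contra hη
    push Not at hη
    have h1 := hbig hη
    have : V.valuation β = V.valuation η ^ p := by
      rw [hβeq, Valuation.map_add_eq_of_lt_left _ (by rwa [map_pow]), map_pow]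
    have h2 : (1 : V.ValueGroup) < V.valuation η ^ p := one_lt_pow₀ hη hp.out.ne_zero
    exact not_lt.mpr hβ (this ▸ h2)
  · intro hβ
    have hη : 1 < V.valuation η := by
      by_contra hle
      push Not at hle
      have hGle : V.valuation G < 1 := valuation_G_lt_one hC hp0 hvp hle
      have : V.valuation β ≤ 1 := by
        rw [hβeq]
        refine Valuation.map_add_le _ ?_ (Valuation.map_add_le _ (by rwa [Valuation.map_neg]) hGle.le)
        rw [map_pow]; exact pow_le_one₀ zero_le hle
      exact not_lt.mpr this hβ
    have h1 := hbig hη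
    refine ⟨hη, ?_, ?_⟩
    · rw [hβeq, Valuation.map_add_eq_of_lt_left _ (by rwa [map_pow]), map_pow]
    · rw [hβeq, show η ^ p - (η ^ p + (-η + G)) = -(-η + G) by ring, Valuation.map_neg]
      exact h1

end Transform

/-! ### Prop. 4.13: the residue degree of a Galois extension of degree `p` -/

namespace IsDenseLiftedFrobeniusClosedBasis

variable {V} {p : ℕ} [hp : Fact p.Prime] [CharP (ResidueField V) p] {K F : Subfield Ω} {B : Set Ω}
variable (h : IsDenseLiftedFrobeniusClosedBasis V p K F B)
  (hF : IsHenselianField F (V.comap (algebraMap F Ω)))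
  {C : Ω} (hCK : C ∈ K) (hC : C ^ (p - 1) = -(p : Ω)) (hp0 : (p : Ω) ≠ 0)
  (hKroot : ∀ c ∈ K, ∃ d ∈ K, d ^ p = c)
  (hKval : ∀ a ∈ F, a ≠ 0 → ∃ c ∈ K, V.valuation c = V.valuation a)
  (hrank : IsRankOneValued V F)
include h hF hCK hC hp0 hKroot hKval hrank

omit hp [CharP (ResidueField V) p] hF hCK hC hp0 hKroot hKval hrank in
/-- The residue of a `K`-linear combination of `B` with coefficients in `V` is the corresponding
`K̄`-linear combination of the residues. [folklore] -/
theorem resid_lc (f : B →₀ K) (hf : ∀ u, (f u : Ω) ∈ V) :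
    resid V (f.sum fun u c => (c : Ω) * (u : Ω)) = ∑ u ∈ f.support, resid V (f u : Ω) * resid V (u : Ω) := by
  rw [lc_eq_sum, resid_sum V _ _ fun u _ => mul_mem (hf u) (h.mem_valuationSubring u.2)]
  exact Finset.sum_congr rfl fun u _ => resid_mul V (hf u) (h.mem_valuationSubring u.2)

omit [CharP (ResidueField V) p] h hF hCK hC hp0 hKroot hKval hrank in
/-- Powers are injective on values: `v(x)^p = γ^p ⇒ v(x) = γ`. [folklore] -/
theorem eq_of_pow_eq_pow {a b : V.ValueGroup} (hab : a ^ p = b ^ p) : a = b := by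
  rcases lt_trichotomy a b with hlt | heq | hgt
  · exact absurd hab (pow_lt_pow_left₀ hlt zero_le hp.out.ne_zero).ne
  · exact heq
  · exact absurd hab (pow_lt_pow_left₀ hgt zero_le hp.out.ne_zero).ne'

/-- **Kuhlmann 2010, Prop. 4.13 (mixed characteristic, residue-transcendental case): the
residue degree of a Galois extension of degree `p` is `≥ p`** — "In all cases, `[Ē : F̄] = p`"
(with the fundamental inequality, `relfinrank_residue_eq_of_isGaloisStep`). Setting: inside the
valued field `(Ω, V)` with `char Ωv = p ≠ char Ω` (`p ≠ 0` in `Ω`), subfields `K ≤ F` with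
`(F, V ∩ F)` henselian of rank one, `C ∈ K` with `C^{p-1} = -p` (so `F ∋ C` contains the `p`-th
roots of unity, Lemma 2.9), `K` closed under `p`-th roots, `vF = vK`, and a dense lifting
`B ⊆ F` of a Frobenius-closed basis of `F̄|K̄` (`IsDenseLiftedFrobeniusClosedBasis`: Lemma 4.7 /
Lemma 4.11); `E|F` Galois of degree `p` inside `Ω`. PROVED along the printed proof: `E = F(ϑ)`,
`ϑ^p = a ∈ F` (Kummer; `exists_kummer_generator_of_isPrimitiveRoot`); `a = c b`, `c ∈ K = K^p`, `vb = 0`; if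
`b̄ ∉ F̄^p` then `ϑ̄ = b̄^{1/p} ∉ F̄` (`le_relfinrank_residue_of_pow_eq`); else `b = b₀^p u` with a
`1`-unit `u`, normalised by `normal_form` to `u ≡ 1 + ∑ c_u u + R` (level-`0` support); for
`η = (ϑ - 1)/C`, a root of `η^p - η + G(η) = β = (∑ c_u u + R)/C^p` (`add_inv_pow_sub_eq`): if
`vβ = 0`, `η̄^p - η̄ = β̄` has no root in `F̄` (else Hensel's Lemma, `exists_root_of_isHenselianField`,
would make `u` a `p`-th power) — the Artin–Schreier exit
`le_relfinrank_residue_of_pow_sub_self_eq`; if `vβ < 0`, `χ = eη` (`e ∈ K`, `v(eη) = 0`) has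
`χ̄^p = ∑ ē_u ū` with a non-zero coefficient at a `u` which is not a `p`-th power in `B`, hence
`χ̄^p ∉ F̄^p` by Lemma 4.8 b) (`exists_apply_eq_of_linearCombination_eq_pow`) — the purely
inseparable exit. [cite: Kuhlmann2010, Prop. 4.13] -/
theorem le_relfinrank_residue_of_isGaloisStep {E : Subfield Ω} (hstep : IsGaloisStep p F E) :
    p ≤ (residueSubfield F V).relfinrank (residueSubfield E V) := by
  classical
  haveI : NeZero p := ⟨hp.out.ne_zero⟩
  have hvp : V.valuation (p : Ω) < 1 := valuation_p_lt_one
  have hCF : C ∈ F := h.le hCK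
  have hC0 : C ≠ 0 := C_ne_zero hp.out hC hp0
  have hvC0 : V.valuation C ≠ 0 := (map_ne_zero _).mpr hC0
  have hΛ0 : 0 < V.valuation C ^ p := pow_pos (zero_lt_iff.mpr hvC0) _
  have hle : F ≤ E := hstep.le
  have hfin : 0 < Subfield.relfinrank F E := by
    rw [hstep.isNormalStep.relfinrank_eq]; exact hp.out.pos
  obtain ⟨-, hfres, -⟩ := relIndex_mul_relfinrank_le_relfinrank V hle hfin
  obtain ⟨ζ, hζF, hζ⟩ := exists_isPrimitiveRoot (V := V) hF hCF hC hp0 hvp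
  -- `ϑ ∉ F` transfers to "`ϑ^p` is not a `p`-th power in `F`"
  have hnp : ∀ ϑ ∈ E, ϑ ∉ F → ∀ b ∈ F, b ^ p ≠ ϑ ^ p := by
    intro ϑ hϑE hϑF b hbF heq
    have hb0 : b ≠ 0 := by
      rintro rfl
      rw [zero_pow hp.out.ne_zero, eq_comm] at heq
      exact hϑF (((pow_eq_zero_iff hp.out.ne_zero).mp heq) ▸ F.zero_mem)
    have h1 : (ϑ / b) ^ p = 1 := by rw [div_pow, ← heq, div_self (pow_ne_zero _ hb0)]
    obtain ⟨i, -, hi⟩ := hζ.eq_pow_of_pow_eq_one h1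
    have : ϑ = ζ ^ i * b := by rw [hi, div_mul_cancel₀ _ hb0]
    exact hϑF (this ▸ mul_mem (_root_.pow_mem hζF i) hbF)
  ------------------------------------------------------------------ the case of a `1`-unit
  have inner : ∀ ϑ ∈ E, ϑ ∉ F → ∀ u ∈ F, ϑ ^ p = u → V.valuation (u - 1) < 1 →
      p ≤ (residueSubfield F V).relfinrank (residueSubfield E V) := by
    intro ϑ hϑE hϑF u huF hϑu hu1
    rcases h.normal_form hF hCF hC hp0 hvp hKroot hrank huF hu1 with
      ⟨z, hzF, -, hz⟩ | ⟨Fc, hFc0, hsupp, R, hRF, hRlt, hΛ, hlc1, z, hzF, hz0, hz⟩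
    · exact absurd (by rw [hz, one_mul]) (hϑu ▸ hnp ϑ hϑE hϑF z hzF)
    -- `ϑ' = ϑ/z` has `ϑ'^p = 1 + b`, `b = lc Fc + R`
    set L := Fc.sum fun u c => (c : Ω) * (u : Ω) with hL
    set b := L + R with hb
    have hbF : b ∈ F := add_mem (h.lc_mem Fc) hRF
    have hbval : V.valuation b = V.valuation L := Valuation.map_add_eq_of_lt_left _ hRlt
    set ϑ' := ϑ / z with hϑ'
    have hϑ'E : ϑ' ∈ E := div_mem hϑE (hle hzF)
    have hϑ'F : ϑ' ∉ F := fun hmem => hϑF (by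
      have : ϑ = ϑ' * z := by rw [hϑ', div_mul_cancel₀ _ hz0]
      rw [this]; exact mul_mem hmem hzF)
    have hϑ'p : ϑ' ^ p = 1 + b := by
      rw [hϑ', div_pow, hϑu, hz, hb, ← add_assoc, mul_div_assoc, div_self (pow_ne_zero _ hz0), mul_one]
    have hnp' : ∀ b' ∈ F, b' ^ p ≠ 1 + b := fun b' hb'F => hϑ'p ▸ hnp ϑ' hϑ'E hϑ'F b' hb'F
    -- `η = (ϑ' - 1)/C` is a root of the transformed equation
    set d := C⁻¹ with hd
    have hdK : d ∈ K := K.inv_mem hCK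
    set η := (ϑ' - 1) * d with hη
    have hηE : η ∈ E := mul_mem (sub_mem hϑ'E E.one_mem) (hle (h.le hdK))
    have hηd : η + d = ϑ' * d := by rw [hη]; ring
    set G := ∑ k ∈ Finset.range (p - 2), η ^ (k + 2) * C⁻¹ ^ (p - (k + 2)) * (p.choose (k + 2) : Ω) with hG
    set β := b * d ^ p with hβ
    have hβF : β ∈ F := mul_mem hbF (_root_.pow_mem (h.le hdK) p)
    have hroot : η ^ p - η + G - β = 0 := by
      have h1 := add_inv_pow_sub_eq hC hp0 η b
      rw [← hd, hηd, mul_pow, hϑ'p, sub_self] at h1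
      rw [hβ, hG, hd]
      exact h1.symm
    have hvβ : V.valuation β = V.valuation L / V.valuation C ^ p := by
      rw [hβ, map_mul, hbval, map_pow, hd, map_inv₀, inv_pow, div_eq_mul_inv]
    obtain ⟨hcase1, hcase2⟩ := valuation_root_transform (V := V) hC hp0 hvp hroot
    rcases hΛ.eq_or_lt with hΛeq | hΛlt
    · ---------------------------------------------------------------- the Artin–Schreier exit
      have hvβ1 : V.valuation β = 1 := by rw [hvβ, ← hΛeq, div_self (ne_of_gt hΛ0)]
      have hη1 : V.valuation η ≤ 1 := hcase1 hvβ1.le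
      have hηV : η ∈ V := (V.valuation_le_one_iff η).mp hη1
      have hβV : β ∈ V := (V.valuation_le_one_iff β).mp hvβ1.le
      have hGval : V.valuation G < 1 := valuation_G_lt_one hC hp0 hvp hη1
      have hGV : G ∈ V := (V.valuation_le_one_iff G).mp hGval.le
      -- `η̄^p - η̄ = β̄`
      have hres : resid V η ^ p - resid V η = resid V β := by
        have h0 : resid V (η ^ p - η + G - β) = 0 := by rw [hroot, resid_zero]
        rw [resid_sub V (add_mem (sub_mem (_root_.pow_mem hηV p) hηV) hGV) hβV,
          resid_add V (sub_mem (_root_.pow_mem hηV p) hηV) hGV, resid_sub V (_root_.pow_mem hηV p) hηV,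
          resid_pow V hηV, (resid_eq_zero_iff V hGV).mpr hGval, add_zero, sub_eq_zero] at h0
        exact h0
      refine le_relfinrank_residue_of_pow_sub_self_eq hle hfres (resid_mem_residueSubfield V hηE)
        (resid_mem_residueSubfield V hβF) hres fun s hs hcontra => ?_
      -- a root of `Y^p - Y - β̄` in `F̄` lifts by Hensel's Lemma: `1 + b` would be a `p`-th power
      obtain ⟨s₀, hs₀F, hs₀V, rfl⟩ := exists_resid_eq_of_mem_residueSubfield V hs
      obtain ⟨hmon, hcoef, hder⟩ := kummerPoly_monic_coeff (V := V) hC hp0 hvp hCF hbF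
        (by rw [hbval]; exact hΛeq.ge)
      have happrox : V.valuation (((Polynomial.X + Polynomial.C C⁻¹) ^ p -
          Polynomial.C ((1 + b) * C⁻¹ ^ p)).eval s₀) < 1 := by
        have heval : ((Polynomial.X + Polynomial.C C⁻¹) ^ p - Polynomial.C ((1 + b) * C⁻¹ ^ p)).eval s₀ =
            (s₀ + C⁻¹) ^ p - (1 + b) * C⁻¹ ^ p := by simp
        rw [heval, add_inv_pow_sub_eq hC hp0 s₀ b, ← hd]
        have hGs : V.valuation (∑ k ∈ Finset.range (p - 2), s₀ ^ (k + 2) * d ^ (p - (k + 2)) *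
            (p.choose (k + 2) : Ω)) < 1 := valuation_G_lt_one hC hp0 hvp ((V.valuation_le_one_iff s₀).mpr hs₀V)
        have hGsV := (V.valuation_le_one_iff _).mp hGs.le
        rw [← hβ, ← resid_eq_zero_iff V (sub_mem (add_mem (sub_mem (_root_.pow_mem hs₀V p) hs₀V) hGsV) hβV),
          resid_sub V (add_mem (sub_mem (_root_.pow_mem hs₀V p) hs₀V) hGsV) hβV,
          resid_add V (sub_mem (_root_.pow_mem hs₀V p) hs₀V) hGsV, resid_sub V (_root_.pow_mem hs₀V p) hs₀V,
          resid_pow V hs₀V, (resid_eq_zero_iff V hGsV).mpr hGs, add_zero, hcontra, sub_self]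
      obtain ⟨y, hyF, -, hy, -⟩ := exists_root_of_isHenselianField V hF hmon hcoef hs₀F hs₀V happrox
        (hder s₀ hs₀V)
      have hy' : (y + d) ^ p = (1 + b) * d ^ p := by
        have := hy
        simp only [Polynomial.eval_sub, Polynomial.eval_pow, Polynomial.eval_add, Polynomial.eval_X,
          Polynomial.eval_C] at this
        rw [← hd] at this
        exact sub_eq_zero.mp this
      refine hnp' (C * (y + d)) (mul_mem hCF (add_mem hyF (h.le hdK))) ?_
      rw [mul_pow, hy', hd, inv_pow, mul_left_comm, mul_inv_cancel₀ (pow_ne_zero _ hC0), mul_one]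
    · ---------------------------------------------------------------- the purely inseparable exit
      have hvβ1 : 1 < V.valuation β := by
        rw [hvβ, lt_div_iff₀ hΛ0, one_mul]; exact hΛlt
      obtain ⟨hη1, hηp, hηβ⟩ := hcase2 hvβ1
      -- the dominant coefficient and the normalising constant `e ∈ K`, `v(e) = v(η)⁻¹`
      obtain ⟨u₀, hu₀, hLu₀, hmax⟩ := h.exists_valuation_lc_eq Fc hFc0
      have hf₀0 : (Fc u₀ : Ω) ≠ 0 := fun h0 => (Finsupp.mem_support_iff.mp hu₀) (Subtype.ext h0)
      obtain ⟨e, heK, he⟩ := hKroot (C ^ p / (Fc u₀ : Ω)) (div_mem (_root_.pow_mem hCK p) (Fc u₀).2)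
      have hve : V.valuation e = (V.valuation η)⁻¹ := by
        refine eq_of_pow_eq_pow (p := p) ?_
        rw [← map_pow, he, map_div₀, map_pow, inv_pow, hηp, hvβ, hLu₀, inv_div]
      have he0 : e ≠ 0 := by
        rintro rfl
        rw [map_zero, eq_comm, inv_eq_zero] at hve
        exact (ne_of_gt (lt_trans zero_lt_one hη1)) hve
      set χ := e * η with hχ
      have hχE : χ ∈ E := mul_mem (hle (h.le heK)) hηE
      have hvχ : V.valuation χ = 1 := by
        rw [hχ, map_mul, hve, inv_mul_cancel₀ (ne_of_gt (lt_trans zero_lt_one hη1))]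
      have hχV : χ ∈ V := (V.valuation_le_one_iff χ).mp hvχ.le
      -- the rescaled coefficients `κ Fc`, `κ = (e d)^p`
      set κ : K := ⟨(e * d) ^ p, _root_.pow_mem (mul_mem heK hdK) p⟩ with hκ
      have hκΩ : (κ : Ω) = (e * d) ^ p := rfl
      have hL0 : V.valuation L ≠ 0 := ne_of_gt (lt_of_lt_of_le hΛ0 hΛ)
      have hκval : V.valuation (κ : Ω) * V.valuation L = 1 := by
        rw [hκΩ, map_pow, map_mul, mul_pow, hve, hd, map_inv₀, inv_pow, inv_pow, hηp, hvβ, inv_div,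
          div_eq_mul_inv, mul_right_comm, inv_mul_cancel_right₀ hL0, mul_inv_cancel₀ (ne_of_gt hΛ0)]
      set Fc' := κ • Fc with hFc'
      have hFc'u : ∀ u, (Fc' u : Ω) = (κ : Ω) * (Fc u : Ω) := fun u => by
        rw [hFc', Finsupp.smul_apply, smul_eq_mul, Subfield.coe_mul]
      have hFc'val : ∀ u, V.valuation (Fc' u : Ω) ≤ 1 := fun u => by
        rw [hFc'u, map_mul, ← hκval, hLu₀]
        exact mul_le_mul_right (hmax u) _
      have hFc'u₀ : V.valuation (Fc' u₀ : Ω) = 1 := by rw [hFc'u, map_mul, ← hLu₀, hκval]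
      have hFc'V : ∀ u, (Fc' u : Ω) ∈ V := fun u => (V.valuation_le_one_iff _).mp (hFc'val u)
      have hL' : (Fc'.sum fun u c => (c : Ω) * (u : Ω)) = (κ : Ω) * L := by rw [hFc', lc_smul]
      have hL'V : (Fc'.sum fun u c => (c : Ω) * (u : Ω)) ∈ V := by
        rw [← V.valuation_le_one_iff]
        exact h.valuation_lc_le fun u _ => hFc'val u
      -- `χ^p ≡ lc Fc'` modulo the maximal ideal
      have hdiff : V.valuation (χ ^ p - Fc'.sum fun u c => (c : Ω) * (u : Ω)) < 1 := by
        have key : χ ^ p - (Fc'.sum fun u c => (c : Ω) * (u : Ω)) = e ^ p * (η ^ p - β) + (κ : Ω) * R := by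
          rw [hL', hχ, mul_pow, hκΩ, hβ, hb]; ring
        rw [key]
        refine Valuation.map_add_lt _ ?_ ?_
        · rw [map_mul, map_pow, hve, inv_pow]
          calc (V.valuation η ^ p)⁻¹ * V.valuation (η ^ p - β) < (V.valuation η ^ p)⁻¹ * V.valuation η ^ p :=
                mul_lt_mul_of_pos_left hηβ (inv_pos.mpr (pow_pos (lt_trans zero_lt_one hη1) _))
            _ = 1 := inv_mul_cancel₀ (pow_ne_zero _ (ne_of_gt (lt_trans zero_lt_one hη1)))
        · rw [map_mul]
          have hκ0 : (κ : Ω) ≠ 0 := by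
            rw [hκΩ]; exact _root_.pow_ne_zero _ (mul_ne_zero he0 (inv_ne_zero hC0))
          calc V.valuation (κ : Ω) * V.valuation R < V.valuation (κ : Ω) * V.valuation L :=
                mul_lt_mul_of_pos_left hRlt ((Valuation.pos_iff _).mpr hκ0)
            _ = 1 := hκval
      have hχp : resid V χ ^ p = resid V (Fc'.sum fun u c => (c : Ω) * (u : Ω)) := by
        rw [← resid_pow V hχV]
        exact (resid_eq_resid_iff V (_root_.pow_mem hχV p) hL'V).mpr hdiff
      refine le_relfinrank_residue_of_pow_eq hle hfres (resid_mem_residueSubfield V hχE)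
        (resid_mem_residueSubfield V (h.lc_mem Fc')) hχp fun s hs hcontra => ?_
      -- Lemma 4.8 b): a `p`-th power `∑ ē_u ū` has all its `u` in `B^p`
      obtain ⟨gvec, hgvec⟩ := Finsupp.mem_span_range_iff_exists_finsupp.mp (h.resid_span s hs)
      let ρK : K → residueSubfield K V := fun c => ⟨resid V (c : Ω), resid_mem_residueSubfield V c.2⟩
      have hρK0 : ρK 0 = 0 := Subtype.ext (by simp [ρK])
      set fvec : B →₀ residueSubfield K V := Fc'.mapRange ρK hρK0 with hfvec
      have hlcf : Finsupp.linearCombination (residueSubfield K V) (fun u : B => resid V (u : Ω)) fvec =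
          resid V (Fc'.sum fun u c => (c : Ω) * (u : Ω)) := by
        rw [Finsupp.linearCombination_apply, hfvec, Finsupp.sum_mapRange_index fun u => by simp,
          h.resid_lc Fc' hFc'V, Finsupp.sum]
        refine Finset.sum_congr rfl fun u _ => ?_
        rw [Algebra.smul_def]; rfl
      have heq : Finsupp.linearCombination (residueSubfield K V) (fun u : B => resid V (u : Ω)) fvec =
          (Finsupp.linearCombination (residueSubfield K V) (fun u : B => resid V (u : Ω)) gvec) ^ p := by
        rw [hlcf, ← hcontra, Finsupp.linearCombination_apply, ← hgvec]
      have hu₀f : u₀ ∈ fvec.support := by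
        rw [Finsupp.mem_support_iff, hfvec, Finsupp.mapRange_apply]
        intro h0
        have : resid V (Fc' u₀ : Ω) = 0 := congrArg Subtype.val h0
        exact ((resid_ne_zero_iff V (hFc'V u₀)).mpr hFc'u₀) this
      obtain ⟨j, hj⟩ := exists_apply_eq_of_linearCombination_eq_pow p h.resid_linearIndependent
        (fun j : B => (⟨(j : Ω) ^ p, h.pow_mem j j.2⟩ : B)) (fun j => resid_pow V (h.mem_valuationSubring j.2) p)
        fvec gvec heq u₀ hu₀f
      have hu₀Fc : u₀ ∈ Fc.support := hu₀
      exact (hsupp u₀ hu₀Fc).2 j j.2 (congrArg Subtype.val hj)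
  ------------------------------------------------------------------ reduction to a `1`-unit
  obtain ⟨ϑ, hϑE, hϑF, hϑp⟩ := exists_kummer_generator_of_isPrimitiveRoot hstep ⟨ζ, hζF, hζ⟩
  have hϑ0 : ϑ ≠ 0 := fun h0 => hϑF (h0 ▸ F.zero_mem)
  obtain ⟨c, hcK, hc⟩ := hKval (ϑ ^ p) hϑp (pow_ne_zero _ hϑ0)
  have hc0 : c ≠ 0 := fun h0 => by
    rw [h0, map_zero, eq_comm, map_eq_zero] at hc
    exact pow_ne_zero _ hϑ0 hc
  obtain ⟨dd, hddK, hdd⟩ := hKroot c hcK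
  have hdd0 : dd ≠ 0 := by rintro rfl; rw [zero_pow hp.out.ne_zero] at hdd; exact hc0 hdd.symm
  set ϑ₁ := ϑ / dd with hϑ₁
  have hϑ₁E : ϑ₁ ∈ E := div_mem hϑE (hle (h.le hddK))
  have hϑ₁F : ϑ₁ ∉ F := fun hmem => hϑF (by
    have : ϑ = ϑ₁ * dd := by rw [hϑ₁, div_mul_cancel₀ _ hdd0]
    rw [this]; exact mul_mem hmem (h.le hddK))
  set b₀ := ϑ ^ p / c with hb₀
  have hb₀F : b₀ ∈ F := div_mem hϑp (h.le hcK)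
  have hϑ₁p : ϑ₁ ^ p = b₀ := by rw [hϑ₁, div_pow, hdd]
  have hvb₀ : V.valuation b₀ = 1 := by rw [hb₀, map_div₀, hc, div_self (by rw [← hc, map_ne_zero]; exact hc0)]
  have hb₀V : b₀ ∈ V := (V.valuation_le_one_iff _).mp hvb₀.le
  have hvϑ₁ : V.valuation ϑ₁ = 1 := eq_of_pow_eq_pow (p := p) (by rw [← map_pow, hϑ₁p, hvb₀, one_pow])
  have hϑ₁V : ϑ₁ ∈ V := (V.valuation_le_one_iff _).mp hvϑ₁.le
  have hres₁ : resid V ϑ₁ ^ p = resid V b₀ := by rw [← resid_pow V hϑ₁V, hϑ₁p]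
  by_cases hroot : ∃ s ∈ residueSubfield F V, s ^ p = resid V b₀
  · -- `b̄₀ = s̄^p`: pass to the `1`-unit `u = b₀/s^p`
    obtain ⟨s, hs, hsp⟩ := hroot
    obtain ⟨s₀, hs₀F, hs₀V, rfl⟩ := exists_resid_eq_of_mem_residueSubfield V hs
    have hs₀0 : resid V s₀ ≠ 0 := by
      intro h0
      rw [h0, zero_pow hp.out.ne_zero, eq_comm, resid_eq_zero_iff V hb₀V] at hsp
      exact (lt_irrefl _) (hvb₀ ▸ hsp)
    have hvs₀ : V.valuation s₀ = 1 := (resid_ne_zero_iff V hs₀V).mp hs₀0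
    have hs₀ne : s₀ ≠ 0 := fun h0 => by rw [h0, map_zero] at hvs₀; exact zero_ne_one hvs₀
    set u := b₀ / s₀ ^ p with hu
    have huF : u ∈ F := div_mem hb₀F (_root_.pow_mem hs₀F p)
    have hvu : V.valuation u = 1 := by rw [hu, map_div₀, hvb₀, map_pow, hvs₀, one_pow, div_one]
    have huV : u ∈ V := (V.valuation_le_one_iff _).mp hvu.le
    have hu1 : V.valuation (u - 1) < 1 := by
      rw [← resid_eq_resid_iff V huV V.one_mem, resid_one]
      have h1 : resid V u * resid V (s₀ ^ p) = resid V b₀ := by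
        rw [← resid_mul V huV (_root_.pow_mem hs₀V p), hu, div_mul_cancel₀ _ (pow_ne_zero _ hs₀ne)]
      rw [resid_pow V hs₀V, ← hsp] at h1
      exact mul_left_eq_self₀.mp h1 |>.resolve_right (pow_ne_zero _ hs₀0)
    refine inner (ϑ₁ / s₀) (div_mem hϑ₁E (hle hs₀F)) (fun hmem => hϑ₁F ?_) u huF
      (by rw [div_pow, hϑ₁p]) hu1
    have : ϑ₁ = ϑ₁ / s₀ * s₀ := by rw [div_mul_cancel₀ _ hs₀ne]
    rw [this]; exact mul_mem hmem hs₀F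
  · -- `b̄₀ ∉ F̄^p`: `ϑ̄₁ = b̄₀^{1/p} ∉ F̄`
    push Not at hroot
    exact le_relfinrank_residue_of_pow_eq hle hfres (resid_mem_residueSubfield V hϑ₁E)
      (resid_mem_residueSubfield V hb₀F) hres₁ hroot

/-- **Kuhlmann 2010, Prop. 4.13: "In all cases, `[Ē : F̄] = p`"** (with the fundamental
inequality `(vE:vF)[Ē:F̄] ≤ [E:F] = p`). PROVED. [cite: Kuhlmann2010, Prop. 4.13] -/
theorem relfinrank_residue_eq_of_isGaloisStep {E : Subfield Ω} (hstep : IsGaloisStep p F E) :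
    (residueSubfield F V).relfinrank (residueSubfield E V) = p := by
  have hge := h.le_relfinrank_residue_of_isGaloisStep hF hCK hC hp0 hKroot hKval hrank hstep
  have hfin : 0 < Subfield.relfinrank F E := by
    rw [hstep.isNormalStep.relfinrank_eq]; exact hp.out.pos
  obtain ⟨he, -, hef⟩ := relIndex_mul_relfinrank_le_relfinrank V hstep.le hfin
  rw [hstep.isNormalStep.relfinrank_eq] at hef
  refine le_antisymm ?_ hge
  calc (residueSubfield F V).relfinrank (residueSubfield E V)
      = 1 * (residueSubfield F V).relfinrank (residueSubfield E V) := (one_mul _).symm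
    _ ≤ (valueSubgroup F V).relIndex (valueSubgroup E V) *
          (residueSubfield F V).relfinrank (residueSubfield E V) := Nat.mul_le_mul_right _ he
    _ ≤ p := hef

end IsDenseLiftedFrobeniusClosedBasis

end Literature.AlgebraicGeometry.Resolution
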